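import Summits.Ventures.HSemireg.VoisinBarrier
import HarnessLib

/-!
# Venture HSemireg — the TWISTED Voisin barrier («no `h` in `κ`, no semiregularity»): STATEMENT of the
# cell's THEOREM T5-23, in Markman's class `κ(E) = ch(E)·exp(-c₁(E)/r)`

HONEST FRAMING. Lean index of the computation cell `pub-hsemireg` (target seat t-5, note
`run/shared/lean/pub/pub-hsemireg/target-g6/T5-AUDIT-M3.md` §19 «THEOREM T5-23 (V-tw)», 2026-08-22). This file TYPES A
STATEMENT and proves only bookkeeping about it. `VoisinBarrierKappa C` below is NOT a published theorem and NOT a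
Literature fact: it is the statement of a SEAT-DERIVED result of the cell (×1 at filing; reads routed by the target
lead, RULING PASS 6 (g4)), assembled on paper from printed results — Buchweitz–Flenner 2003 Thm. 5.1 and its proof,
Voisin 2002 (IMRN) §2 / Appendix (Bando–Siu), Markman arXiv:2502.03415 §7.3 and §7.5.2 Steps 1–5 — plus the lemmas of
the cell's notes NORM-VOISIN §3 (THEOREM V: (V1), (V2), Lemma HL) and T5-AUDIT-M3 §19.4 (0) (LEMMA FLAT-SB: flat
Heisenberg projective bundles over families of complex tori). A proof in the tree would need analytic families of
NON-algebraic complex tori, twisted sheaves, and the module deformation theory of [BuchweitzFlenner2003] over an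
analytic germ — none of which has a carrier at the pin. Consumers take `(hV : VoisinBarrierKappa C)` as an explicit
hypothesis. Nothing here constructs an object, nothing here says HC, HC_CM or HC_AV is proved, and nothing here is a
new case of anything: like `VoisinBarrier C` (file `VoisinBarrier.lean`, the untwisted THEOREM V) it is a NEGATIVE
statement about the Bloch / Buchweitz–Flenner / Markman METHOD («where not to look»).

## The statement being typed (T5-AUDIT-M3 §19.3, the honest-sheaf form)

«THEOREM T5-23 (V-tw). Let `A` be an abelian variety of Weil type (`K` imaginary quadratic acting with signature
`(n,n)`, `n ≥ 2`; any discriminant; CM or not) and `E` a locally free sheaf of rank `r > 0` on `A` whose Markman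
class `κ(E) = ch(E)·exp(-c₁(E)/r)` lies in `ℚ·1 ⊕ W_K ⊕ ℚ·[pt]` with non-zero `W_K`-component. Then `σ_E` is NOT
injective — for no set `I` of degrees is `E` `I`-semiregular — WHATEVER `c₁(E)` is.»

For `c₁(E) = 0` this is THEOREM V (`κ = ch`); the content is the case `c₁(E) ∉ ℚ·h` (determinant-twisted designs,
Markman's `μ_r`-twisted sheaves `E ⊗ det(E)^{-1/r}`), where the object deformed by the method is the twisted sheaf /
the projective bundle `ℙ(E)` and the class transported is `κ`, not `ch` ([Markman2025SecantWeil] §7.3, Conj. 7.3.9).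
MECHANISM (note §19.4): `κ` stays of Hodge type on the whole `2n²`-dimensional germ of complex tori with `K`-action;
Markman's proof of his Conj. 7.3.9 (§7.5.2 Steps 1–5: pull back to a projective bundle `ℙ₀ → A` with the Brauer
class of the twist, untwist there to an HONEST sheaf, apply [BuchweitzFlenner2003] Thm. 5.1) runs over that analytic
germ as soon as the projective bundle extends over the family — which a FLAT Heisenberg bundle does (LEMMA FLAT-SB:
`H²(torus, μ_ρ) ≅ Alt²(Λ, μ_ρ)` is realised by clock/shift matrices); tensoring the resulting family with the flat
dual bundle gives an honest vector bundle on the very general `K`-torus whose Chern character has a non-zero Weil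
component — against Voisin's Appendix Cor. 1 (every holomorphic vector bundle there has `ch = rank`).

## Rendering (tree vocabulary only)

* `A`, `φ`, `n`, `d`, `IsWeilType A φ n d`, `E : A.X.left.Modules`, `IsFiniteLocallyFree E`, `IsISemiregular hE I`,
  `IsHFreeWeilCarrying` — exactly as in `VoisinBarrier.lean`.
* The rank: a rational `r ≠ 0` with `ch₀(E) = r·1` (for a vector bundle of rank `r` this is «`ch = r + c₁ + …`»,
  cf. `ChernCharacterBetti.ch_free_zero`; supplied by the consumer, so no rank function is needed).
* `κ_p(E) := Σ_{j=0}^{p} ((-1/r)ʲ/j!) · ch_{p-j}(E) ∪ c₁(E)ʲ` with `c₁(E) := ch₁(E)` — `kappaClass C X E r p`, the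
  degree-`2p` component of `ch(E)·exp(-c₁(E)/r)` written with the tree's `cupProduct` / `cupPowTwo`
  ([Markman2025SecantWeil] §1.3: «`κ(ch) = exp(-ch₁/r) ch`»).

## Contents

* `kappaClass` (DEFINITION, the only one) and its bookkeeping: `kappaClass_eq_ch_of_ch_one_eq_zero` (if `ch₁(E) = 0`
  then `κ_p = ch_p` for all `p` — so on such `E` the two barriers say the same thing, `VoisinBarrierKappa.of_ch_one_eq_zero`).
* `VoisinBarrierKappa C : Prop` (STATEMENT, tagged `@[conjecture]` = open obligation node of the cell).
* `VoisinBarrierKappa.not_isSemiregularReal` — consumer shape («`σ` not injective»).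

## References

* [Markman2025SecantWeil] E. Markman, *Cycles on abelian 2n-folds of Weil type from secant sheaves on abelian
  n-folds*, arXiv:2502.03415: §1.3 (the class `κ`), §7.3 (Defs. 7.3.5, 7.3.6, 7.3.8, Constr. 7.3.3, Rem. 7.3.4,
  Lemma 7.3.7, Conj. 7.3.9), §7.5.2 Steps 1–5 (= public v2 §7.4.2).
* [BuchweitzFlenner2003] R.-O. Buchweitz, H. Flenner, Compositio Math. 137 (2003): Thm. 5.1 and its proof p. 179.
* [Voisin2002KaehlerCounterexample] C. Voisin, IMRN 2002:20 (arXiv:math/0112247): §2 Prop. 1, Appendix Thm. 2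
  (Bando–Siu), Prop. 4, Cor. 1.
* Cell notes (not literature): NORM-VOISIN-gs-eng-1-g9.md §3; T5-AUDIT-M3.md §19.
-/

noncomputable section

open CategoryTheory

namespace Summit.Ventures.HSemireg

open Literature.AlgebraicGeometry Literature.AlgebraicGeometry.Motives
open Literature.AlgebraicGeometry.HodgeTheory
open Literature.AlgebraicTopology.SingularHomology

/-! ## §1 Markman's class `κ(E) = ch(E) · exp(-c₁(E)/r)`, degree by degree -/

/-- Degree bookkeeping for `ch_{p-j} ∪ c₁ʲ ∈ H^{2p}`: `2(p - j) + 2j = 2p` for `j ≤ p`. [folklore] -/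
theorem two_mul_sub_add_two_mul (p : ℕ) (j : Fin (p + 1)) : 2 * (p - (j : ℕ)) + 2 * (j : ℕ) = 2 * p := by
  have := j.2
  omega

/-- **Markman's class `κ(E)`, degree-`2p` component** (DEFINITION): for a Chern character theory `C`, a module `E`
on `X` and a rational «rank» `r` (meant: `ch₀(E) = r·1`, `r ≠ 0`),
`κ_p(E) = Σ_{j=0}^{p} ((-1/r)ʲ / j!) · ch_{p-j}(E) ∪ ch₁(E)ʲ` — the degree-`2p` part of `ch(E)·exp(-c₁(E)/r)` with
`c₁(E) := ch₁(E)`. [cite: Markman2025SecantWeil, §1.3 (κ(ch) = exp(-ch₁/r)·ch) and Def. 7.3.6] -/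
def kappaClass (C : ChernCharacterBetti) (X : SchemeOver ℂ) (E : X.left.Modules) (r : ℚ) (p : ℕ) :
    complexBetti X (2 * p) :=
  ∑ j : Fin (p + 1),
    ((((-r⁻¹) ^ (j : ℕ) / (Nat.factorial (j : ℕ) : ℚ) : ℚ) : ℂ) •
      cupProduct (two_mul_sub_add_two_mul p j) (C.ch X E (p - (j : ℕ))) (cupPowTwo (C.ch X E 1) (j : ℕ)))

/-- Positive cup powers of the zero class vanish: `0ʲ⁺¹ = 0ʲ ∪ 0 = 0`. [cite: HatcherAT2002, §3.2] -/
theorem cupPowTwo_zero_succ {Y : Type} [TopologicalSpace Y] (j : ℕ) :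
    cupPowTwo (0 : singularCohomology ℂ ℂ Y 2) (j + 1) = 0 := by
  rw [cupPowTwo_succ, map_zero]

/-- **If `c₁(E) = ch₁(E) = 0` then `κ_p(E) = ch_p(E)`**: only the `j = 0` term of the sum survives
(`exp(0) = 1`). [cite: Markman2025SecantWeil, §1.3] -/
theorem kappaClass_eq_ch_of_ch_one_eq_zero (C : ChernCharacterBetti) (X : SchemeOver ℂ) (E : X.left.Modules)
    (r : ℚ) (h1 : C.ch X E 1 = 0) (p : ℕ) : kappaClass C X E r p = C.ch X E p := by
  unfold kappaClass
  rw [Fin.sum_univ_succ, Finset.sum_eq_zero, add_zero]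
  · have h0 : ((0 : Fin (p + 1)) : ℕ) = 0 := rfl
    simp only [h0, pow_zero, Nat.factorial_zero, Nat.cast_one, div_one, Rat.cast_one, one_smul]
    exact cupProduct_one (C.ch X E p)
  · intro j _
    have hz : cupPowTwo (0 : complexBetti X (2 * 1)) ((Fin.succ j : Fin (p + 1)) : ℕ) = 0 :=
      cupPowTwo_zero_succ _
    rw [h1, hz, map_zero, smul_zero]

/-! ## §2 THEOREM T5-23 of the cell (the twisted Voisin barrier) — STATEMENT -/

/-- **THE TWISTED VOISIN BARRIER — the cell's THEOREM T5-23 («no `h` in `κ` ⇒ no semiregularity»), STATEMENT ONLY**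
(seat-derived ×1, target seat t-5 gen 5, T5-AUDIT-M3 §19; NOT a published theorem, NOT proved here — consumers take
`(hV : VoisinBarrierKappa C)`): for every abelian variety of Weil type `(A, φ)` of signature `(n, n)`, `n ≥ 2` (any
`K = ℚ(√-d)`, any discriminant, CM or not; `IsWeilType A φ n d`), every FINITE LOCALLY FREE `E` on `A` and every
rational `r ≠ 0` with `ch₀(E) = r·1`, if Markman's class `κ(E) = ch(E)·exp(-c₁(E)/r)` is `h`-free and `W`-carrying —
`κ_p(E) = 0` for `0 < p < 2n`, `p ≠ n`, and `κ_n(E)` a non-zero class of the Weil plane — then `E` is NOT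
`I`-semiregular for ANY set `I` of form degrees; in particular the full Buchweitz–Flenner map
`σ : Ext²(E,E) → ∏_q H^{q+2}(A, Ω^q)` is not injective, whatever `c₁(E)` is. Equivalently ([Markman2025SecantWeil]
Rem. 7.3.4, Lemma 7.3.7, Def. 7.3.8) neither the `μ_r`-twisted sheaf `E ⊗ det(E)^{-1/r}` nor the projective bundle
`ℙ(E)` is semiregular. On paper: Markman's proof of his Conj. 7.3.9 (§7.5.2 Steps 1–5) over the analytic `2n²`-dimensional
`K`-torus germ, with the projective bundle of his Step 1 replaced by a flat Heisenberg bundle (cell lemma FLAT-SB),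
[BuchweitzFlenner2003] Thm. 5.1 (proof p. 179) for the untwisted sheaf on that projective bundle, Grauert base change,
and [Voisin2002KaehlerCounterexample] Appendix Cor. 1 on the very general `K`-torus (cell lemmas (V1), (V2), HL of
NORM-VOISIN). Tagged `@[conjecture]`: an obligation node of the cell, closed by a future
`theorem … : VoisinBarrierKappa C` (or refuted by name). [status: open — seat-derived 2026-08-22, proof not formalised]
[cite: Markman2025SecantWeil, §7.3 Conj. 7.3.9 and §7.5.2 Steps 1–5 (= v2 §7.4.2); §1.3 (κ)]
[cite: BuchweitzFlenner2003, §5 Thm. 5.1 (proof p. 179 L22–38) and §5 (I-semiregular)]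
[cite: Voisin2002KaehlerCounterexample, Appendix Thm. 2, Prop. 4, Cor. 1; §2 Prop. 1] -/
@[conjecture] def VoisinBarrierKappa (C : ChernCharacterBetti) : Prop :=
  ∀ ⦃A : AbelianVariety ℂ⦄ ⦃φ : A ⟶ A⦄ ⦃n d : ℕ⦄, IsWeilType A φ n d → 2 ≤ n →
    ∀ ⦃E : A.X.left.Modules⦄ (hE : IsFiniteLocallyFree E) (r : ℚ), r ≠ 0 →
      C.ch A.X E 0 = ((r : ℚ) : ℂ) • singularCohomology.one ℂ (ComplexPoints A.X) →
      IsHFreeWeilCarrying A φ n d (fun p => kappaClass C A.X E r p) → ∀ I : Set ℕ, ¬ IsISemiregular hE I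

/-! ## §3 Bookkeeping consequences (the content is the hypothesis `hV`) -/

/-- **Not semiregular** (consumer shape): under `VoisinBarrierKappa`, a finite locally free `E` of rank `r ≠ 0` on a
Weil-type `2n`-fold (`n ≥ 2`) whose `κ` is `h`-free and `W`-carrying has a non-injective full semiregularity map.
[cite: BuchweitzFlenner2003, Def. 4.1 and §5] -/
theorem VoisinBarrierKappa.not_isSemiregularReal {C : ChernCharacterBetti} (hV : VoisinBarrierKappa C)
    {A : AbelianVariety ℂ} {φ : A ⟶ A} {n d : ℕ} (hA : IsWeilType A φ n d) (hn : 2 ≤ n)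
    {E : A.X.left.Modules} (hE : IsFiniteLocallyFree E) {r : ℚ} (hr : r ≠ 0)
    (h0 : C.ch A.X E 0 = ((r : ℚ) : ℂ) • singularCohomology.one ℂ (ComplexPoints A.X))
    (hκ : IsHFreeWeilCarrying A φ n d (fun p => kappaClass C A.X E r p)) : ¬ IsSemiregularReal hE := by
  intro hsr
  exact hV hA hn hE r hr h0 hκ Set.univ ((isISemiregular_univ_iff_isSemiregularReal hE).2 hsr)

/-- **Consistency with THEOREM V**: on vector bundles with `ch₁(E) = 0` (and a rank `r ≠ 0` read off `ch₀`),
`κ = ch`, so the twisted barrier gives back the untwisted conclusion of `VoisinBarrier C` for them.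
[cite: Markman2025SecantWeil, §7.3 (paragraph after Conj. 7.3.9: «κ(𝓑') = ch(𝓑')» for trivial determinant)] -/
theorem VoisinBarrierKappa.of_ch_one_eq_zero {C : ChernCharacterBetti} (hV : VoisinBarrierKappa C)
    {A : AbelianVariety ℂ} {φ : A ⟶ A} {n d : ℕ} (hA : IsWeilType A φ n d) (hn : 2 ≤ n)
    {E : A.X.left.Modules} (hE : IsFiniteLocallyFree E) {r : ℚ} (hr : r ≠ 0)
    (h0 : C.ch A.X E 0 = ((r : ℚ) : ℂ) • singularCohomology.one ℂ (ComplexPoints A.X))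
    (h1 : C.ch A.X E 1 = 0) (hch : IsHFreeWeilCarrying A φ n d (fun p => C.ch A.X E p)) (I : Set ℕ) :
    ¬ IsISemiregular hE I := by
  have hκ : IsHFreeWeilCarrying A φ n d (fun p => kappaClass C A.X E r p) := by
    have heq : (fun p => kappaClass C A.X E r p) = fun p => C.ch A.X E p :=
      funext fun p => kappaClass_eq_ch_of_ch_one_eq_zero C A.X E r h1 p
    rw [heq]
    exact hch
  exact hV hA hn hE r hr h0 hκ I

end Summit.Ventures.HSemireg

end
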